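import Literature.NumberTheory.EllipticCurves.H1UnramifiedFinite
import Literature.AnabelianGeometry.AbsoluteAnabelian.LocalResidueFixedFieldProofs
import Literature.NumberTheory.GaloisRepresentations.LocalGaloisGroupFrobeniusProofs
import HarnessLib

/-!
# Unramified local cohomology classes with finite coefficients are torsion of BOUNDED exponent:
# for a non-archimedean local field `F` and a finite discrete `Γ_F`-module `M`, every class of
# `H¹(Γ_F, M)` vanishing on the inertia group `I_F` is killed by `#M^{Γ_F}`

Topic `NumberTheory/EllipticCurves` (namespace = path; the discrete-module glue `discreteTopRep` of
`GaloisAction.lean` lives here).  Cell `bsd-cn100`, prover seat `bsd-cn100-transfer-2` (g6).  THEOREMS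
ONLY (no definition, no named fact, no `sorry`, no instance, no notation).  Brick (L2a) of the
discharge of the READING-grade named fact `Kato2004.locP_kernel_isTorsion_of_rankOne` (conjunct 11
of the citation-borne stub of the registered `kato-zeta-perrin-riou` lines on
stmt-BirchSwinnertonDyer-19080 / -19160; assembly held by seat `bsd-cn100-s2-c3` g9): at a bad place
`v ∤ p` the reductions modulo `p^k` of an INTEGRAL class of `T_pW` are unramified but need not
satisfy the Kummer local condition; this file supplies the local exponent, UNIFORM in the
coefficient module up to the size of its `Γ_F`-fixed points (for `M = E[p^k]`: `#E(F)[p^k] ≤ #E(F)[p^∞]`),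
that pushes them into the local condition (indeed kills their restriction to `Γ_F` outright).
Nothing about BSD is claimed.

## What (for `F` a non-archimedean local field, `Γ_F = Gal(F̄/F)`, `I_F = absInertia F`, and a
## discrete `Γ_F`-module `M` with continuous action)

* §1 **`oneCocycle_eq_zero_of_absInertia_of_isFrobPow`** — a continuous `1`-cocycle
  `ψ : Γ_F → M` with `ψ|_{I_F} = 0` and `ψ(φ) = 0` for ONE Frobenius `φ` (`IsFrobPow φ 1`) is
  identically `0`.  PROOF: the zero locus `{g | ψ g = 0}` of a `1`-cocycle is a subgroup
  (`ψ(gh) = ψ g + g·ψ h`), open (`M` discrete), containing `I_F` and `φ`; every `g ∈ Γ_F` is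
  `φ^j · h` with `h` in that open subgroup (density of the Weil group,
  `exists_zpow_inv_mul_mem`), so `ψ g = 0`.
* §2 **`smul_apply_eq_of_mem_absInertia`** — the values of an `I_F`-trivial cocycle are
  `I_F`-invariant; **`mem_fixedPoints_of_absInertia_of_isFrobPow`** — a point fixed by `I_F` and by
  one Frobenius is fixed by `Γ_F` (same density argument on the open stabiliser).
* §3 **`card_fixedPoints_nsmul_oneCocycleClass_eq_zero_of_absInertia`** (`M` finite) — for `ψ`
  with `ψ|_{I_F} = 0`: `#M^{Γ_F} • [ψ] = 0` in `H¹(Γ_F, M)`.  PROOF: on the finite group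
  `N = M^{I_F}` (which contains the values of `ψ` and is `φ`-stable, `I_F` being normal) the
  endomorphism `T = φ − 1` has `#(N ⧸ T N) = # ker T = #M^{Γ_F} =: e` (§2); so
  `e·ψ(φ) = φ m − m` for some `m ∈ N`, and the cocycle `e·ψ − ∂m` vanishes on `I_F` and at `φ`,
  hence everywhere (§1): `e·[ψ] = [∂m] = 0`.  Corollary **`nsmul_oneCocycleClass_eq_zero_of_absInertia_of_dvd`**
  (any multiple of `#M^{Γ_F}` kills the class) — the shape for a bound uniform in a family of
  coefficient modules.

This is the elementary content of "`H¹(F^nr/F, M^{I_F}) ≅ M^{I_F}/(Frob − 1)` is finite of order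
`#H⁰(F, M)`" (Serre, *Local Fields* XIII §1; Milne, *ADT* I §2, proof of Thm. 2.6 / Lemma 2.10:
`#H¹(ĝ, N) = #H⁰(ĝ, N)` for finite `N`), proved on continuous cochains of `Γ_F` without naming
`F^nr` or `Ẑ`.

References: J.-P. Serre, *Local Fields* (1979) XIII §1, XIII §4 [SerreLocalFields1979]; J.-P. Serre,
*Galois Cohomology* (1997) I §2.2, II §5.5 [SerreGaloisCohomology1997]; J. S. Milne, *Arithmetic
Duality Theorems* (2006) I §2 (Lemma 2.10, `h(ĝ, N)`-computation) [MilneADT2006]; J. Tate, *Number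
theoretic background*, Corvallis (1979) (1.4.1) [TateCorvallis1979]; tree:
`AbsoluteAnabelian/LocalResidueFixedFieldProofs.lean` (`exists_zpow_inv_mul_mem`,
`normal_of_absInertia_le`), `GaloisRepresentations/LocalGaloisGroupFrobeniusProofs.lean`
(`exists_isAbsArithFrob_holds`), `EllipticCurves/H1UnramifiedFinite.lean` / `GaloisAction.lean`
(`discreteTopRep`, cocycle classes).
-/

noncomputable section

open scoped Pointwise
open Field ValuativeRel
open Literature.NumberTheory.GaloisRepresentations

universe u

namespace Literature.NumberTheory.EllipticCurves

variable {F : Type u} [Field F] [ValuativeRel F] [TopologicalSpace F] [IsNonarchimedeanLocalField F]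
variable {M : Type u} [AddCommGroup M] [DistribMulAction (absoluteGaloisGroup F) M]
  [TopologicalSpace M] [DiscreteTopology M]

/-! ## §1 A cocycle vanishing on inertia and at one Frobenius vanishes -/

/-- **A continuous `1`-cocycle of `Γ_F` with discrete coefficients which vanishes on the inertia
group `I_F` and at one Frobenius element `φ` vanishes identically.**  The zero locus of a
`1`-cocycle is an open subgroup; it contains `I_F` and `φ`, hence every `φ^j h`, `h` in it — i.e.
all of `Γ_F` (density of the Weil group, `exists_zpow_inv_mul_mem`).
[cite: SerreLocalFields1979, Ch. XIII §4] [cite: TateCorvallis1979, §1.4 (1.4.1)] -/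
theorem oneCocycle_eq_zero_of_absInertia_of_isFrobPow
    (ψ : contOneCocycles (discreteTopRep (absoluteGaloisGroup F) M))
    (hI : ∀ σ ∈ absInertia F, ψ.1 σ = 0) {φ : absoluteGaloisGroup F} (hφ : IsFrobPow φ 1)
    (hφ0 : ψ.1 φ = 0) : ψ = 0 := by
  -- the zero locus of `ψ`, an open subgroup
  let Z : Subgroup (absoluteGaloisGroup F) :=
    { carrier := {g | ψ.1 g = 0}
      one_mem' := contOneCocycles.apply_one ψ
      mul_mem' := fun {a b} ha hb => by
        change ψ.1 (a * b) = 0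
        rw [ψ.2 a b, ha, hb, map_zero, add_zero]
      inv_mem' := fun {a} ha => by
        change ψ.1 a⁻¹ = 0
        have h := ψ.2 a⁻¹ a
        rw [inv_mul_cancel, contOneCocycles.apply_one, ha, map_zero, add_zero] at h
        exact h.symm }
  have hZopen : IsOpen (Z : Set (absoluteGaloisGroup F)) :=
    (isOpen_discrete ({0} : Set M)).preimage ψ.1.continuous
  have hIZ : absInertia F ≤ Z := fun σ hσ => hI σ hσ
  have hφZ : φ ∈ Z := hφ0
  refine Subtype.ext (ContinuousMap.ext fun g => ?_)
  obtain ⟨j, hj⟩ := exists_zpow_inv_mul_mem hIZ hZopen hφ g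
  have hg : g ∈ Z := by
    have h := Z.mul_mem (Z.zpow_mem hφZ j) hj
    rwa [mul_inv_cancel_left] at h
  exact hg

/-! ## §2 Inertia-trivial cocycles take `I_F`-invariant values; `I_F`- and `φ`-fixed points are `Γ_F`-fixed -/

/-- The values of a `1`-cocycle vanishing on the normal subgroup `I_F` are `I_F`-invariant:
`σ • ψ(g) = ψ(g)` for `σ ∈ I_F` (from `ψ(σ g) = σ ψ(g)` and `σ g = g (g⁻¹ σ g)`).
[cite: SerreGaloisCohomology1997, I §2.2] -/
theorem smul_apply_eq_of_mem_absInertia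
    (ψ : contOneCocycles (discreteTopRep (absoluteGaloisGroup F) M))
    (hI : ∀ σ ∈ absInertia F, ψ.1 σ = 0) {σ : absoluteGaloisGroup F} (hσ : σ ∈ absInertia F)
    (g : absoluteGaloisGroup F) : σ • ψ.1 g = ψ.1 g := by
  haveI : (absInertia F).Normal := normal_of_absInertia_le le_rfl
  have h1 : ψ.1 (σ * g) = σ • ψ.1 g := by
    rw [ψ.2 σ g, hI σ hσ, zero_add]; rfl
  have h2 : ψ.1 (σ * g) = ψ.1 g := by
    have hconj : g⁻¹ * σ * g ∈ absInertia F := by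
      have := Subgroup.Normal.conj_mem inferInstance σ hσ g⁻¹
      simpa using this
    have : σ * g = g * (g⁻¹ * σ * g) := by group
    rw [this, ψ.2, hI _ hconj, map_zero, add_zero]
  rw [← h1, h2]

/-- **A point fixed by the inertia group and by one Frobenius is fixed by all of `Γ_F`** (its
stabiliser is an open subgroup containing `I_F` and `φ`; density of the Weil group).
[cite: SerreLocalFields1979, Ch. XIII §4] [cite: TateCorvallis1979, §1.4 (1.4.1)] -/
theorem mem_fixedPoints_of_absInertia_of_isFrobPow [ContinuousSMul (absoluteGaloisGroup F) M]
    {m : M} (hI : ∀ σ ∈ absInertia F, σ • m = m) {φ : absoluteGaloisGroup F} (hφ : IsFrobPow φ 1)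
    (hφm : φ • m = m) : m ∈ MulAction.fixedPoints (absoluteGaloisGroup F) M := by
  intro g
  have hopen : IsOpen (MulAction.stabilizer (absoluteGaloisGroup F) m : Set (absoluteGaloisGroup F)) :=
    stabilizer_isOpen (absoluteGaloisGroup F) m
  have hIle : absInertia F ≤ MulAction.stabilizer (absoluteGaloisGroup F) m := fun σ hσ => hI σ hσ
  obtain ⟨j, hj⟩ := exists_zpow_inv_mul_mem hIle hopen hφ g
  have hφs : φ ∈ MulAction.stabilizer (absoluteGaloisGroup F) m := hφm
  have hg : g ∈ MulAction.stabilizer (absoluteGaloisGroup F) m := by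
    have h := (MulAction.stabilizer (absoluteGaloisGroup F) m).mul_mem
      ((MulAction.stabilizer (absoluteGaloisGroup F) m).zpow_mem hφs j) hj
    rwa [mul_inv_cancel_left] at h
  exact hg

/-! ## §3 The exponent bound `#M^{Γ_F}` for inertia-trivial classes -/

/-- **Unramified classes are killed by `#M^{Γ_F}`.**  For a finite discrete `Γ_F`-module `M` with
continuous action and a continuous `1`-cocycle `ψ` vanishing on `I_F`:
`(#M^{Γ_F}) • [ψ] = 0` in `H¹(Γ_F, M)` (module docstring §3: on `N = M^{I_F}` the map `φ − 1` has
cokernel of order `# ker = #M^{Γ_F}`, so `#M^{Γ_F} · ψ(φ) = φ m − m`, and `#M^{Γ_F}·ψ − ∂m` vanishes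
on `I_F` and at `φ`).  This is "`H¹(F^nr/F, M^{I_F})` has order `#H⁰(F, M)`" on cochains.
[cite: MilneADT2006, Ch. I §2 (Lemma 2.10)] [cite: SerreLocalFields1979, Ch. XIII §1] -/
theorem card_fixedPoints_nsmul_oneCocycleClass_eq_zero_of_absInertia [Finite M]
    [ContinuousSMul (absoluteGaloisGroup F) M]
    (ψ : contOneCocycles (discreteTopRep (absoluteGaloisGroup F) M))
    (hI : ∀ σ ∈ absInertia F, ψ.1 σ = 0) :
    Nat.card (MulAction.fixedPoints (absoluteGaloisGroup F) M) •
      oneCocycleClass (discreteTopRep (absoluteGaloisGroup F) M) ψ = 0 := by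
  classical
  haveI : (absInertia F).Normal := normal_of_absInertia_le le_rfl
  -- a Frobenius
  obtain ⟨φ, hφa⟩ := exists_isAbsArithFrob_holds (F := F)
  have hφ : IsFrobPow φ 1 := IsAbsArithFrob.isFrobPow_holds hφa
  -- `N = M^{I_F}`, stable under `φ`
  let N : AddSubgroup M :=
    { carrier := {m | ∀ σ ∈ absInertia F, σ • m = m}
      zero_mem' := fun σ _ => smul_zero σ
      add_mem' := fun {a b} ha hb σ hσ => by rw [smul_add, ha σ hσ, hb σ hσ]
      neg_mem' := fun {a} ha σ hσ => by rw [smul_neg, ha σ hσ] }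
  have hφN : ∀ m ∈ N, φ • m ∈ N := fun m hm σ hσ => by
    have hconj : φ⁻¹ * σ * φ ∈ absInertia F := by
      have := Subgroup.Normal.conj_mem inferInstance σ hσ φ⁻¹
      simpa using this
    calc σ • φ • m = φ • ((φ⁻¹ * σ * φ) • m) := by
          rw [← mul_smul, ← mul_smul]; congr 1; group
      _ = φ • m := by rw [hm _ hconj]
  -- the endomorphism `T = φ − 1` of `N`
  let T : N →+ N :=
    { toFun := fun m => ⟨φ • (m : M) - m, N.sub_mem (hφN m m.2) m.2⟩
      map_zero' := Subtype.ext (by simp)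
      map_add' := fun a b => Subtype.ext (by
        simp only [AddSubgroup.coe_add, smul_add]
        abel) }
  haveI : Finite N := Subtype.finite
  -- `#(N ⧸ T N) = # ker T`
  have hcard : Nat.card (N ⧸ T.range) = Nat.card T.ker := by
    have h1 : Nat.card N = Nat.card (N ⧸ T.range) * Nat.card T.range :=
      AddSubgroup.card_eq_card_quotient_mul_card_addSubgroup T.range
    have h2 : Nat.card N = Nat.card (N ⧸ T.ker) * Nat.card T.ker :=
      AddSubgroup.card_eq_card_quotient_mul_card_addSubgroup T.ker
    have h3 : Nat.card (N ⧸ T.ker) = Nat.card T.range :=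
      Nat.card_congr (QuotientAddGroup.quotientKerEquivRange T).toEquiv
    rw [h3, mul_comm] at h2
    have hpos : 0 < Nat.card T.range := Nat.card_pos
    exact Nat.eq_of_mul_eq_mul_right hpos (h1.symm.trans h2)
  -- `ker T = M^{Γ_F}` (as types)
  have hker : Nat.card T.ker = Nat.card (MulAction.fixedPoints (absoluteGaloisGroup F) M) := by
    refine Nat.card_congr ?_
    refine Equiv.ofBijective (fun m => ⟨((m : N) : M), ?_⟩) ⟨?_, ?_⟩
    · have hm : φ • ((m : N) : M) - (m : N) = 0 := by
        have := m.2
        rw [AddMonoidHom.mem_ker] at this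
        exact congrArg (fun x : N => (x : M)) this
      exact mem_fixedPoints_of_absInertia_of_isFrobPow (m : N).2 hφ (sub_eq_zero.mp hm)
    · intro a b hab
      have h := congrArg (fun x : MulAction.fixedPoints (absoluteGaloisGroup F) M => (x : M)) hab
      exact Subtype.ext (Subtype.ext h)
    · intro x
      have hxN : (x : M) ∈ N := fun σ _ => x.2 σ
      have hxT : (⟨(x : M), hxN⟩ : N) ∈ T.ker := by
        rw [AddMonoidHom.mem_ker]
        exact Subtype.ext (by
          change φ • (x : M) - (x : M) = 0
          rw [sub_eq_zero]; exact x.2 φ)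
      exact ⟨⟨_, hxT⟩, rfl⟩
  -- `a = ψ(φ) ∈ N` and `e • a ∈ T N`, `e = #M^{Γ_F}`
  have ha : ψ.1 φ ∈ N := fun σ hσ => smul_apply_eq_of_mem_absInertia ψ hI hσ φ
  have heq : Nat.card (MulAction.fixedPoints (absoluteGaloisGroup F) M) •
      (QuotientAddGroup.mk (⟨ψ.1 φ, ha⟩ : N) : N ⧸ T.range) = 0 := by
    rw [← hker, ← hcard]
    exact card_nsmul_eq_zero'
  rw [← QuotientAddGroup.mk_nsmul, QuotientAddGroup.eq_zero_iff] at heq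
  obtain ⟨m, hm⟩ := heq
  have hm' : φ • ((m : N) : M) - (m : N) =
      Nat.card (MulAction.fixedPoints (absoluteGaloisGroup F) M) • ψ.1 φ := by
    have := congrArg (fun x : N => (x : M)) hm
    simpa [T] using this
  set e : ℕ := Nat.card (MulAction.fixedPoints (absoluteGaloisGroup F) M) with he
  -- the coboundary `∂m` and the cocycle `e • ψ − ∂m`
  let cob : contOneCocycles (discreteTopRep (absoluteGaloisGroup F) M) :=
    ⟨⟨fun σ ↦ σ • ((m : N) : M) - (m : N), (continuous_id.smul continuous_const).sub continuous_const⟩,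
      fun σ τ ↦ by
        change (σ * τ) • ((m : N) : M) - (m : N) =
          (σ • ((m : N) : M) - (m : N)) + σ • (τ • ((m : N) : M) - (m : N))
        rw [mul_smul, smul_sub]; abel⟩
  have hcob : oneCocycleClass _ cob = 0 :=
    (oneCocycleClass_eq_zero_iff _ cob).mpr ⟨((m : N) : M), fun _ ↦ rfl⟩
  have hzero : (e : ℤ) • ψ - cob = 0 := by
    refine oneCocycle_eq_zero_of_absInertia_of_isFrobPow _ (fun σ hσ => ?_) hφ ?_
    · change (e : ℤ) • ψ.1 σ - (σ • ((m : N) : M) - (m : N)) = 0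
      rw [hI σ hσ, smul_zero, (m : N).2 σ hσ, sub_self, sub_zero]
    · change (e : ℤ) • ψ.1 φ - (φ • ((m : N) : M) - (m : N)) = 0
      rw [hm', Nat.cast_smul_eq_nsmul, sub_self]
  have h := congrArg (oneCocycleClass (discreteTopRep (absoluteGaloisGroup F) M)) hzero
  rw [oneCocycleClass_sub, oneCocycleClass_smul, hcob, sub_zero, oneCocycleClass_zero,
    Nat.cast_smul_eq_nsmul] at h
  exact h

/-- **Uniform form**: any multiple `B` of `#M^{Γ_F}` kills every inertia-trivial class of
`H¹(Γ_F, M)` — the shape used with a bound `B` independent of the member of a family of coefficient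
modules (e.g. `M = E[p^k]`, `#E(F)[p^k] ∣ p^t` for `p^t ≥ #E(F)[p^∞]`).
[cite: MilneADT2006, Ch. I §2 (Lemma 2.10)] -/
theorem nsmul_oneCocycleClass_eq_zero_of_absInertia_of_dvd [Finite M]
    [ContinuousSMul (absoluteGaloisGroup F) M]
    (ψ : contOneCocycles (discreteTopRep (absoluteGaloisGroup F) M))
    (hI : ∀ σ ∈ absInertia F, ψ.1 σ = 0) {B : ℕ}
    (hB : Nat.card (MulAction.fixedPoints (absoluteGaloisGroup F) M) ∣ B) :
    B • oneCocycleClass (discreteTopRep (absoluteGaloisGroup F) M) ψ = 0 := by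
  have h := card_fixedPoints_nsmul_oneCocycleClass_eq_zero_of_absInertia ψ hI
  exact addOrderOf_dvd_iff_nsmul_eq_zero.mp ((addOrderOf_dvd_iff_nsmul_eq_zero.mpr h).trans hB)

/-- **Class form**: every class `c ∈ H¹(Γ_F, M)` restricting to zero on the inertia group
(`subgroupResKer M I_F`, i.e. `c|_{I_F} = 0` in `H¹(I_F, M)`) is killed by `#M^{Γ_F}`.  (A class in
the restriction kernel has a cocycle with `ψ|_{I_F} = ∂a`; replacing `ψ` by `ψ − ∂a` one may assume
`ψ|_{I_F} = 0`.)  [cite: MilneADT2006, Ch. I §2 (Lemma 2.10)] [cite: SerreGaloisCohomology1997, I §2.2] -/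
theorem card_fixedPoints_nsmul_eq_zero_of_mem_subgroupResKer_absInertia [Finite M]
    [ContinuousSMul (absoluteGaloisGroup F) M]
    {c : discreteH1 (absoluteGaloisGroup F) M} (hc : c ∈ subgroupResKer M (absInertia F)) :
    Nat.card (MulAction.fixedPoints (absoluteGaloisGroup F) M) • c = 0 := by
  obtain ⟨ψ, rfl⟩ := oneCocycleClass_surjective (discreteTopRep (absoluteGaloisGroup F) M) c
  obtain ⟨a, ha⟩ := (oneCocycleClass_mem_subgroupResKer_iff (absInertia F) ψ).mp hc
  -- replace `ψ` by `ψ − ∂a`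
  let cob : contOneCocycles (discreteTopRep (absoluteGaloisGroup F) M) :=
    ⟨⟨fun σ ↦ σ • a - a, (continuous_id.smul continuous_const).sub continuous_const⟩,
      fun σ τ ↦ by
        change (σ * τ) • a - a = (σ • a - a) + σ • (τ • a - a)
        rw [mul_smul, smul_sub]; abel⟩
  have hcob : oneCocycleClass _ cob = 0 :=
    (oneCocycleClass_eq_zero_iff _ cob).mpr ⟨a, fun _ ↦ rfl⟩
  have hI : ∀ σ ∈ absInertia F, (ψ - cob).1 σ = 0 := fun σ hσ => by
    change ψ.1 σ - (σ • a - a) = 0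
    rw [ha ⟨σ, hσ⟩, sub_self]
  have h := card_fixedPoints_nsmul_oneCocycleClass_eq_zero_of_absInertia (ψ - cob) hI
  rwa [oneCocycleClass_sub, hcob, sub_zero] at h

end Literature.NumberTheory.EllipticCurves

end
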